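import Summits.CriticalPhenomena.PercolationContinuityZ3.Theses.PercClusterResistance
import Summits.CriticalPhenomena.PercolationContinuityZ3.Theorems.PercNearOneGluingNoHeavyLowerTailCSHTheoremOne
import Literature.Probability.Percolation.SupercriticalClusterTransienceProofs
import Literature.Probability.Percolation.PercolationProofs
import HarnessLib

/-!
# `PercClusterResistance.ClusterTransient` (stmt-CriticalPhenomena-5591) — SETTLED after continuity

Item `stmt-CriticalPhenomena-5591` of route `CriticalPhenomena/PercClusterResistance` (crux r3): for every `p ∈ [0,1]`
with `θ(p) > 0`, for `P_p`-a.e. configuration in which `C(0)` is infinite there is a finite-energy unit flow from `0`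
to `∞` on the open subgraph of `ℤ³` (T. Lyons' criterion: the infinite cluster is transient).

Proof.  The case `p > p_c(ℤ³)` is Grimmett–Kesten–Zhang 1993, PROVED in the tree
(`GrimmettKestenZhang1993_flow_holds`, Literature file `SupercriticalClusterTransienceProofs.lean`, with the `d = 3`
instance `GrimmettKestenZhang1993_flow.three` in the exact shape of the item); the item's docstring notes that 'the live
case is a percolating `p_c`'.  With `θ(p_c(ℤ³)) = 0` (p205010) there is no such case: `θ(p) > 0` and `θ`
non-decreasing (`theta_mono_holds`) force `p > p_c`.

builds on p205010 (kernel theorem, internal audit signed; external expert review pending) — USED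
(`CSH.percolationContinuityZ3_holds`).  RSW3 lane, prover P2 gen 32 (prover-prim-rsw3-p2-g32-0), METHOD '3D RSW-lite
from continuity'.
References: G. Grimmett, H. Kesten, Y. Zhang (1993) [GrimmettKestenZhang1993]; R. Lyons, Y. Peres (2016), Thm. 2.11
[LyonsPeres2016]; G. Kozma, N. Nitzan (2024) [KozmaNitzan2024].
-/

noncomputable section

namespace Summit.CriticalPhenomena.PercolationContinuityZ3.Theorems

namespace ClusterResistanceClusterTransient

open MeasureTheory Literature.Probability.Percolation Literature.Probability.LatticeModels

/-- **`θ(p) > 0` puts `p` strictly above `p_c(ℤ³)`** (p205010 + monotonicity of `θ`).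
[cite: KozmaNitzan2024, Thm. 6 with Conj. 3 (p. 15)] -/
theorem criticalProbI_lt_of_theta_pos {p : unitInterval} (hθ : 0 < theta (zdGraph 3) (0 : Site 3) p) :
    ((criticalProbI 3 : unitInterval) : ℝ) < (p : ℝ) := by
  by_contra hle
  have hle' : p ≤ criticalProbI 3 := Subtype.coe_le_coe.1 (not_lt.1 hle)
  have hmono := theta_mono_holds (zdGraph 3) (0 : Site 3) hle'
  have h0 : theta (zdGraph 3) (0 : Site 3) (criticalProbI 3) = 0 := CSH.percolationContinuityZ3_holds
  linarith

/-- **`PercClusterResistance.ClusterTransient` (stmt-CriticalPhenomena-5591), settled**: Grimmett–Kesten–Zhang for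
`p > p_c(ℤ³)`, which by p205010 is every `p` with `θ(p) > 0`. [cite: GrimmettKestenZhang1993, Thm. 2] -/
theorem clusterTransient_proof :
    Summit.CriticalPhenomena.PercolationContinuityZ3.Theses.PercClusterResistance.ClusterTransient := by
  intro p hθ
  exact GrimmettKestenZhang1993_flow.three GrimmettKestenZhang1993_flow_holds p (criticalProbI_lt_of_theta_pos hθ)

end ClusterResistanceClusterTransient

end Summit.CriticalPhenomena.PercolationContinuityZ3.Theorems

end
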